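import Literature.IUT.LogVolume.GenuineThetaFieldCyclotomicRamification
import Literature.IUT.LogVolume.GenuineTowerFacts
import Literature.IUT.LogVolume.GenuineLogThetaPointNecessity
import Literature.IUT.LogVolume.Corollary22FullGaloisImage
import Literature.NumberTheory.EllipticCurves.QuadraticTwistDescentProofs
import Literature.NumberTheory.EllipticCurves.TorsionRationalDescentProofs
import Literature.NumberTheory.EllipticCurves.VariableChangePointsMap
import Mathlib.NumberTheory.Cyclotomic.PrimitiveRoots
import Mathlib.RingTheory.Polynomial.Cyclotomic.Roots
import HarnessLib

/-!
# The free curve of a genuine Θ-volume datum at a rational point IS the Legendre curve over `F`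
# (the twist class of `E_F` against `E_λ` is trivial: model reading v3 costs nothing at `λ ∈ ℚ`)

Mochizuki, *Inter-universal Teichmüller theory IV* (RIMS manuscript Apr. 2020 = PRIMS **57** (2021)), Cor. 2.2 (ii)
proof p. 46 / Thm. 1.10 p. 22: the initial Θ-data of a point `λ` of the `λ`-line are built on "the elliptic curve `E_F`"
of `x_E = λ` with "the `(3·5)`-torsion points of `E_F` defined over `F`", `F = F_tpd(√−1, E_{F_tpd}[3·5])`. The cell's
typed datum `Cor22.ThetaVolumeDatumAt P l` (abc-iut-S2, model reading v3) carries a FREE Weierstrass curve `T.E` over a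
free number field `T.F ⊇ F_tpd`, pinned only by `j(T.E) = j(λ)` (`j_eq`), by "`T.E[30] ⊆ T.E(F)`" (`torsion_thirty_rational`)
and by `Cor22.IsSubThetaField P T.F` (`F` is generated over `F_tpd` by square roots of `−1, λ, λ−1` lying in `F` and by
the coordinates of the `F`-rational `15`-torsion points of the LEGENDRE curve `E_λ : y² = x(x−1)(x−λ)`).

THIS FILE PROVES that at a RATIONAL point (`F_tpd = ℚ`, `j(λ) ≠ 1728`) these three clauses already force
**`T.E ≅_F E_λ ⊗ F`** (`ThetaVolumeDatumAt.exists_variableChange_thetaCurve_ratPoint`: `C₀ • T.E = thetaCurve (ratPoint q) T.F`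
for a change of variables `C₀` OVER `T.F`). Proof (Silverman *AEC* III.1, X.5.4): over `F̄`, `C • T.E = E_λ` (same `j`) with
`u(C)² = α ∈ F`, `r, s, t ∈ F` (abc-iut-L5-t12's quadratic-twist descent, [IUTchIV] Prop. 1.8 (ii)/(iii) in real form; the
target has `a₁ = a₃ = 0`); if `α` is a square in `F`, `C` is Galois-fixed and descends; if NOT, transporting the `F`-rational
`15`-torsion of `T.E` along `(x, y) ↦ (u⁻²(x − r), u⁻³(y − s(x − r) − t))` shows that `E_λ(F)` has no non-zero point killed
by `15`, so `torsionCoords P F = ∅` and `IsSubThetaField` leaves only square roots of `−1, λ, λ−1` as generators: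
`[F : F_tpd] ≤ 8` — contradicting `ζ₆₀ ∈ F` (`√−1 ∈ F` by [IUTchI] Def. 3.1 (a); `ζ₃, ζ₅ ∈ F` by the Weil pairing,
abc-iut-W-neg-1's `exists_isPrimitiveRoot_F`; `[ℚ(ζ₆₀) : ℚ] = φ(60) = 16`). CONSEQUENCE (abc-iut R-W window table, input
«LBt»): the «twist factor `2`» of the local type is a THEOREM about the typed datum, with NO model clause (sequel file;
compare abc-iut-W-neg-2's conditional `Cor312GenuineKTwistLowerBound`, hypothesis `IsSquare (algebraMap ℚ F λ)`, which
print's `F_E = ℚ(√−1, E_λ[15])` need not satisfy).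

Proof-only (no definition, no named fact, no instance); inputs BY NAME; TAKES NO SIDE on [IUTchIII] Cor. 3.12.
[cite: Mochizuki2012, IUTchIV Thm. 1.10 p. 22; Cor. 2.2 (ii) proof p. 46] [cite: SilvermanAEC2009, III.1 Table 3.1, Prop. X.5.4, Cor. III.8.1.1]
[cite: Washington1997, Thm. 2.5] [claim: Mochizuki2012, status: disputed] for every IUT quotation.
-/

noncomputable section

open scoped Classical

namespace Literature.IUT.LogVolume

namespace Cor22

namespace ThetaVolumeDatumAt

open NumberField IsDedekindDomain Literature.NumberTheory.DiophantineGeometry.GenEll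
open Literature.NumberTheory.EllipticCurves Literature.NumberTheory.NumberFields Literature.IUT.HodgeTheaters
open WeierstrassCurve IntermediateField Field Polynomial

variable {P : NFPoint} {l : ℕ} (T : ThetaVolumeDatumAt P l)

/-! ## §1. `[F : F_tpd]` is finite (from the tower facts) -/

/-- `F/F_tpd` is a finite extension (its degree divides `2^a·3²·5` by the tower facts of abc-iut-S-d1/S3, so it is
non-zero). [cite: Mochizuki2012, IUTchIV Thm. 1.10 proof Step (ii) p. 24] [claim: Mochizuki2012, status: disputed] -/
theorem finite_tpd_F :
    letI := T.instFieldF; letI := T.instNumberFieldF; letI := T.instAlgebraF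
    Module.Finite P.F T.F := by
  letI := T.instFieldF; letI := T.instNumberFieldF; letI := T.instAlgebraF; letI := T.instFieldK
  letI := T.instNumberFieldK; letI := T.instAlgebraK; letI := T.instFieldFbar; letI := T.instAlgebraFbar
  letI := T.instAlgebraKFbar; letI := T.instIsElliptic
  obtain ⟨a, -, hdvd⟩ := (T.towerFacts T.inU).2.2.2.1
  refine Module.finite_of_finrank_pos (Nat.pos_of_ne_zero fun h0 => ?_)
  rw [h0, zero_dvd_iff] at hdvd
  exact absurd hdvd (by positivity)

/-! ## §2. A field generated by square roots of three elements has degree `≤ 8` -/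

/-- For `m ∈ K` and a finite extension `F/K`: the subfield generated by ALL square roots of `m` lying in `F` has degree
`≤ 2` over `K` (it is `K`, or `K(r)` with `r² = m`). [folklore] -/
private theorem finrank_adjoin_sqrts_le_two {K F : Type} [Field K] [Field F] [Algebra K F] [Module.Finite K F] (m : K) :
    Module.finrank K (IntermediateField.adjoin K {x : F | x ^ 2 = algebraMap K F m}) ≤ 2 := by
  by_cases h : ∃ r : F, r ^ 2 = algebraMap K F m
  · obtain ⟨r, hr⟩ := h
    have heq : IntermediateField.adjoin K {x : F | x ^ 2 = algebraMap K F m} = K⟮r⟯ := by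
      refine le_antisymm (IntermediateField.adjoin_le_iff.mpr fun x hx => ?_)
        (IntermediateField.adjoin_simple_le_iff.mpr (IntermediateField.subset_adjoin _ _ hr))
      have hx' : x ^ 2 = r ^ 2 := by rw [hr]; exact hx
      rcases eq_or_eq_neg_of_sq_eq_sq x r hx' with h | h
      · rw [h]; exact IntermediateField.mem_adjoin_simple_self K r
      · rw [h]; exact neg_mem (IntermediateField.mem_adjoin_simple_self K r)
    rw [heq, IntermediateField.adjoin.finrank (Algebra.IsIntegral.isIntegral r)]
    have hp0 : (X ^ 2 - C m : K[X]) ≠ 0 := X_pow_sub_C_ne_zero (by norm_num) m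
    have hdvd : minpoly K r ∣ X ^ 2 - C m := minpoly.dvd K r (by simp [hr])
    calc (minpoly K r).natDegree ≤ (X ^ 2 - C m : K[X]).natDegree := Polynomial.natDegree_le_of_dvd hdvd hp0
      _ = 2 := natDegree_X_pow_sub_C
  · have hempty : {x : F | x ^ 2 = algebraMap K F m} = ∅ :=
      Set.eq_empty_iff_forall_notMem.mpr fun x hx => h ⟨x, hx⟩
    rw [hempty, IntermediateField.adjoin_empty, IntermediateField.finrank_bot]
    norm_num

/-- If `F = K(S)` where every element of `S` is a square root of `−1`, of `c` or of `c − 1`, then `[F : K] ≤ 8`. [folklore] -/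
private theorem finrank_le_eight_of_adjoin_sqrts_eq_top {K F : Type} [Field K] [Field F] [Algebra K F] [Module.Finite K F]
    (c : K) (h : IntermediateField.adjoin K
      {x : F | x ^ 2 = -1 ∨ x ^ 2 = algebraMap K F c ∨ x ^ 2 = algebraMap K F c - 1} = ⊤) :
    Module.finrank K F ≤ 8 := by
  have hset : {x : F | x ^ 2 = -1 ∨ x ^ 2 = algebraMap K F c ∨ x ^ 2 = algebraMap K F c - 1} =
      {x : F | x ^ 2 = algebraMap K F (-1)} ∪ {x : F | x ^ 2 = algebraMap K F c} ∪
        {x : F | x ^ 2 = algebraMap K F (c - 1)} := by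
    ext x
    simp only [map_neg, map_one, map_sub, Set.mem_setOf_eq, Set.mem_union]
    tauto
  rw [hset, IntermediateField.adjoin_union, IntermediateField.adjoin_union] at h
  have h1 := finrank_adjoin_sqrts_le_two (K := K) (F := F) (-1)
  have h2 := finrank_adjoin_sqrts_le_two (K := K) (F := F) c
  have h3 := finrank_adjoin_sqrts_le_two (K := K) (F := F) (c - 1)
  rw [← IntermediateField.finrank_top', ← h]
  calc _ ≤ _ := IntermediateField.finrank_sup_le _ _
    _ ≤ (2 * 2) * 2 := by
        gcongr
        calc _ ≤ _ := IntermediateField.finrank_sup_le _ _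
          _ ≤ 2 * 2 := by gcongr
    _ = 8 := by norm_num

/-! ## §3. No `F`-rational `15`-torsion on `E_λ` ⟹ `[F : F_tpd] ≤ 8` (the pinning clause `IsSubThetaField`) -/

/-- If the Legendre curve `E_λ` over `T.F` has NO non-zero `F`-rational point killed by `15`, then `torsionCoords P F = ∅`
and the pinning clause `IsSubThetaField P F` leaves only the square roots of `−1, λ, λ−1` as generators:
**`[F : F_tpd] ≤ 8`**. [cite: Mochizuki2012, IUTchIV Thm. 1.10 p. 22] [claim: Mochizuki2012, status: disputed] -/
theorem finrank_le_eight_of_forall_torsion_eq_zero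
    (h : letI := T.instFieldF; letI := T.instNumberFieldF; letI := T.instAlgebraF
      ∀ Q : (thetaCurve P T.F).toAffine.Point, (15 : ℤ) • Q = 0 → Q = 0) :
    letI := T.instFieldF; letI := T.instNumberFieldF; letI := T.instAlgebraF
    Module.finrank P.F T.F ≤ 8 := by
  letI := T.instFieldF; letI := T.instNumberFieldF; letI := T.instAlgebraF
  haveI := T.finite_tpd_F
  have hempty : torsionCoords P T.F = ∅ := by
    refine Set.eq_empty_iff_forall_notMem.mpr fun z hz => ?_
    unfold torsionCoords at hz
    simp only [Set.mem_iUnion, Set.mem_setOf_eq, exists_prop] at hz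
    obtain ⟨Q, hQ, hzQ⟩ := hz
    rw [h Q hQ] at hzQ
    exact hzQ
  have htop := T.isSubThetaField.adjoin_eq_top
  rw [subThetaFieldGenerators, hempty, Set.union_empty] at htop
  exact finrank_le_eight_of_adjoin_sqrts_eq_top P.x htop

/-! ## §4. At a rational point: `ζ₆₀ ∈ F`, so `[F : ℚ] ≥ 16` -/

/-- A square root of `−1` is a primitive `4`-th root of unity (characteristic `≠ 2`). [folklore] -/
private theorem isPrimitiveRoot_four_of_sq_eq_neg_one {F : Type} [Field F] [CharZero F] {i : F} (hi : i ^ 2 = -1) :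
    IsPrimitiveRoot i 4 := by
  refine IsPrimitiveRoot.mk_of_lt i (by norm_num) (by rw [show (4 : ℕ) = 2 * 2 by rfl, pow_mul, hi]; norm_num) ?_
  intro k hk hk4
  interval_cases k
  · rw [pow_one]; intro h1; rw [h1] at hi; norm_num at hi
  · rw [hi]; norm_num
  · rw [show (3 : ℕ) = 2 + 1 by rfl, pow_succ, hi]
    intro h; have : i = -1 := by linear_combination -h
    rw [this] at hi; norm_num at hi

/-- **At a rational point `[F : ℚ] ≥ 16`**: `√−1 ∈ F` ([IUTchI] Def. 3.1 (a)) and `ζ₃, ζ₅ ∈ F` (Weil pairing on `T.E[3]`,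
`T.E[5] ⊆ T.E(F)`, abc-iut-W-neg-1's `exists_isPrimitiveRoot_F`), so `ζ₆₀ ∈ F` and `ℚ(ζ₆₀) ⊆ F` has degree `φ(60) = 16`
(irreducibility of `Φ₆₀` over `ℚ`). [cite: Washington1997, Thm. 2.5] [cite: Mochizuki2012, IUTchI Def. 3.1 (a) p. 61]
[claim: Mochizuki2012, status: disputed] -/
theorem sixteen_le_finrank_ratPoint {q : ℚ} {l : ℕ} (T : ThetaVolumeDatumAt (ratPoint q) l) :
    letI := T.instFieldF; letI := T.instNumberFieldF; letI := T.instAlgebraF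
    16 ≤ Module.finrank (ratPoint q).F T.F := by
  letI := T.instFieldF; letI := T.instNumberFieldF; letI := T.instAlgebraF; letI := T.instFieldK
  letI := T.instNumberFieldK; letI := T.instAlgebraK; letI := T.instFieldFbar; letI := T.instAlgebraFbar
  letI := T.instAlgebraKFbar; letI := T.instIsElliptic
  haveI := T.finite_tpd_F
  obtain ⟨i, hi⟩ := T.D.sqrt_neg_one_mem
  have h4 : IsPrimitiveRoot i 4 := isPrimitiveRoot_four_of_sq_eq_neg_one hi
  obtain ⟨ζ₃, h3⟩ := T.exists_isPrimitiveRoot_F (p := 3) (by norm_num) (by norm_num)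
  obtain ⟨ζ₅, h5⟩ := T.exists_isPrimitiveRoot_F (p := 5) (by norm_num) (by norm_num)
  have h12 := h4.pow_mul_pow_lcm h3 (by norm_num) (by norm_num)
  rw [show Nat.lcm 4 3 = 12 by norm_num] at h12
  have h60 := h12.pow_mul_pow_lcm h5 (by norm_num) (by norm_num)
  rw [show Nat.lcm 12 5 = 60 by norm_num] at h60
  set ζ : T.F := _ with hζdef
  change IsPrimitiveRoot ζ 60 at h60
  haveI : Algebra.IsIntegral (ratPoint q).F T.F := Algebra.IsIntegral.of_finite _ _
  haveI := h60.intermediateField_adjoin_isCyclotomicExtension (K := (ratPoint q).F)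
  have hirr : Irreducible (cyclotomic 60 (ratPoint q).F) := cyclotomic.irreducible_rat (by norm_num)
  have hdeg : Module.finrank (ratPoint q).F (IntermediateField.adjoin (ratPoint q).F {ζ}) = Nat.totient 60 :=
    IsCyclotomicExtension.finrank (n := 60) _ hirr
  have htot : Nat.totient 60 = 16 := by decide
  have hle := Submodule.finrank_le (IntermediateField.adjoin (ratPoint q).F {ζ}).toSubalgebra.toSubmodule
  rw [Subalgebra.finrank_toSubmodule] at hle
  change Module.finrank (ratPoint q).F (IntermediateField.adjoin (ratPoint q).F {ζ}) ≤ _ at hle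
  rw [hdeg, htot] at hle
  exact hle

/-! ## §5. The twist class of `T.E` against the Legendre curve `E_λ` -/

/-- **Dichotomy (any base point `P` with `j(λ) ≠ 0, 1728`).** EITHER `T.E ≅_F E_λ ⊗ F` (a change of variables OVER `F`
carries `T.E` to `thetaCurve P F`), OR the Legendre curve `E_λ` has no non-zero `F`-rational point killed by `15`.
(Over `F̄`: `C • T.E = E_λ` with `u(C)² = α ∈ F`, `r, s, t ∈ F` — abc-iut-L5-t12's quadratic-twist descent; if `α` is a
square in `F` the change of variables is Galois-fixed and descends; if not, an `F`-rational `15`-torsion point of `E_λ`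
transported from the `F`-rational `15`-torsion of `T.E` would put `u³`, hence `u`, in `F`.)
[cite: SilvermanAEC2009, III.1 Table 3.1 and Prop. X.5.4] [cite: Mochizuki2012, IUTchIV Thm. 1.10 p. 22]
[claim: Mochizuki2012, status: disputed] -/
theorem exists_variableChange_thetaCurve_or_forall_torsion_eq_zero (hj0 : jInv P.x ≠ 0) (hj : jInv P.x ≠ 1728) :
    letI := T.instFieldF; letI := T.instNumberFieldF; letI := T.instAlgebraF; letI := T.instIsElliptic
    (∃ C₀ : VariableChange T.F, C₀ • T.E = thetaCurve P T.F) ∨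
      (∀ Q : (thetaCurve P T.F).toAffine.Point, (15 : ℤ) • Q = 0 → Q = 0) := by
  letI := T.instFieldF; letI := T.instNumberFieldF; letI := T.instAlgebraF; letI := T.instFieldK
  letI := T.instNumberFieldK; letI := T.instAlgebraK; letI := T.instFieldFbar; letI := T.instAlgebraFbar
  letI := T.instAlgebraKFbar; letI := T.instIsElliptic
  haveI := T.D.isAlgClosure
  haveI : IsAlgClosed T.Fbar := IsAlgClosure.isAlgClosed T.F
  haveI : Algebra.IsAlgebraic T.F T.Fbar := IsAlgClosure.isAlgebraic
  haveI : IsGalois T.F T.Fbar := {}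
  haveI : CharZero T.Fbar := charZero_of_injective_algebraMap (algebraMap T.F T.Fbar).injective
  set Θ : WeierstrassCurve T.F := thetaCurve P T.F with hΘdef
  haveI hΘell : Θ.IsElliptic := thetaCurve_isElliptic T.inU T.F
  haveI : (T.E.baseChange T.Fbar).IsElliptic := inferInstanceAs (T.E.map (algebraMap T.F T.Fbar)).IsElliptic
  haveI : (Θ.baseChange T.Fbar).IsElliptic := inferInstanceAs (Θ.map (algebraMap T.F T.Fbar)).IsElliptic
  set ι : T.F →+* T.Fbar := algebraMap T.F T.Fbar with hιdef
  have hιinj : Function.Injective ι := (algebraMap T.F T.Fbar).injective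
  have hjE : T.E.j = Θ.j := by rw [T.j_eq]; exact (thetaCurve_j T.F T.inU).symm
  have hjE0 : T.E.j ≠ 0 := by
    rw [T.j_eq]; exact fun h => hj0 ((map_eq_zero_iff _ (algebraMap P.F T.F).injective).mp h)
  have hjE1728 : T.E.j ≠ 1728 := by
    rw [T.j_eq, ← map_ofNat (algebraMap P.F T.F) 1728]
    exact fun h => hj ((algebraMap P.F T.F).injective h)
  have hjL : (T.E.baseChange T.Fbar).j = (Θ.baseChange T.Fbar).j := by
    change (T.E.map (algebraMap T.F T.Fbar)).j = (Θ.map (algebraMap T.F T.Fbar)).j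
    rw [T.E.map_j, Θ.map_j, hjE]
  obtain ⟨C, hC⟩ := exists_variableChange_of_j_eq (T.E.baseChange T.Fbar) (Θ.baseChange T.Fbar) hjL
  obtain ⟨α, β, hα0, hα, hβ⟩ := VariableChange.exists_u_sq_eq_algebraMap_of_smul_baseChange T.E Θ
    two_ne_zero three_ne_zero hjE0 hjE1728 C hC
  change ((C.u : T.Fbar)) ^ 2 = ι α at hα
  change C.r = ι β at hβ
  -- `s, t ∈ F`: the target `E_λ` has `a₁ = a₃ = 0`
  have hu0 : ((C.u⁻¹ : T.Fbarˣ) : T.Fbar) ≠ 0 := (C.u⁻¹).ne_zero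
  have hΘa₁ : (Θ.baseChange T.Fbar).a₁ = 0 := by
    simp [hΘdef, WeierstrassCurve.baseChange, WeierstrassCurve.map]
  have hΘa₃ : (Θ.baseChange T.Fbar).a₃ = 0 := by
    simp [hΘdef, WeierstrassCurve.baseChange, WeierstrassCurve.map]
  have hEa₁ : (T.E.baseChange T.Fbar).a₁ = ι T.E.a₁ := rfl
  have hEa₃ : (T.E.baseChange T.Fbar).a₃ = ι T.E.a₃ := rfl
  have hs' : ι T.E.a₁ + 2 * C.s = 0 := by
    have h := congrArg WeierstrassCurve.a₁ hC
    rw [variableChange_a₁, hΘa₁, hEa₁] at h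
    exact (mul_eq_zero.mp h).resolve_left hu0
  have ht' : ι T.E.a₃ + ι β * ι T.E.a₁ + 2 * C.t = 0 := by
    have h := congrArg WeierstrassCurve.a₃ hC
    rw [variableChange_a₃, hΘa₃, hEa₃, hEa₁, hβ] at h
    exact (mul_eq_zero.mp h).resolve_left (pow_ne_zero 3 hu0)
  have h2L : (2 : T.Fbar) ≠ 0 := two_ne_zero
  have hs : C.s = ι (-(T.E.a₁) / 2) := by
    rw [map_div₀, map_neg, map_ofNat]
    field_simp
    linear_combination hs'
  have ht : C.t = ι (-(T.E.a₃ + β * T.E.a₁) / 2) := by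
    rw [map_div₀, map_neg, map_add, map_mul, map_ofNat]
    field_simp
    linear_combination ht'
  by_cases hsq : IsSquare α
  · -- Case A: `α = a²`, so `u = ±a ∈ F` and `C` is Galois-fixed, hence defined over `F`
    left
    obtain ⟨a, ha⟩ := hsq
    have hua : (C.u : T.Fbar) = ι a ∨ (C.u : T.Fbar) = -ι a := by
      apply eq_or_eq_neg_of_sq_eq_sq
      rw [hα, ha, map_mul, sq]
    refine exists_variableChange_eq_of_forall_map_algEquiv_eq hC fun σ => ?_
    have hσι : ∀ z : T.F, (σ : T.Fbar →ₐ[T.F] T.Fbar) (ι z) = ι z := fun z =>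
      (σ : T.Fbar →ₐ[T.F] T.Fbar).commutes z
    refine VariableChange.ext (Units.ext ?_) ?_ ?_ ?_ <;>
      simp only [VariableChange.map, Units.coe_map, MonoidHom.coe_coe, RingHom.coe_coe]
    · rcases hua with h | h
      · rw [h]; exact hσι a
      · rw [h, map_neg]; exact congrArg Neg.neg (hσι a)
    · rw [hβ]; exact hσι β
    · rw [hs]; exact hσι _
    · rw [ht]; exact hσι _
  · -- Case B: `α` is not a square in `F`; then `E_λ(F)` has no non-zero point killed by `15`
    right
    intro Q hQ
    cases Q with
    | zero => rfl
    | some x y hxy =>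
      exfalso
      have hxy' : (Θ.baseChange T.Fbar).toAffine.Nonsingular (ι x) (ι y) :=
        (Affine.map_nonsingular (W := Θ.toAffine) (f := ι) hιinj x y).mpr hxy
      set Qb : (Θ.baseChange T.Fbar).toAffine.Point := Affine.Point.some (ι x) (ι y) hxy' with hQbdef
      have hQb15 : (15 : ℤ) • Qb = 0 := by
        have h15 : (15 : ℤ) • (Affine.Point.some x y hxy : (Θ.toAffine.baseChange T.F).Point) = 0 := hQ
        have h := congrArg (Affine.Point.map (W' := Θ.toAffine) (Algebra.ofId T.F T.Fbar)) h15
        rw [map_zsmul, map_zero] at h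
        exact h
      -- pull back along `T.E(F̄) ≃+ E_λ(F̄)`: a point of `T.E(F̄)` killed by `30`, hence `F`-rational
      set R := ((VariableChange.pointEquiv (T.E.baseChange T.Fbar) C).trans (Affine.Point.congrEquiv hC)).symm Qb
        with hRdef
      have hR15 : (15 : ℤ) • R = 0 := by rw [hRdef, ← map_zsmul, hQb15, map_zero]
      have hR30 : (30 : ℤ) • R = 0 := by
        rw [show (30 : ℤ) = 2 * 15 by norm_num, mul_smul, hR15, smul_zero]
      have hφR : ((VariableChange.pointEquiv (T.E.baseChange T.Fbar) C).trans (Affine.Point.congrEquiv hC)) R = Qb := by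
        rw [hRdef]; exact AddEquiv.apply_symm_apply _ Qb
      obtain ⟨R₀, hR₀⟩ := T.torsion_thirty_rational R hR30
      cases R₀ with
      | zero =>
        have hR0 : R = 0 := by rw [← hR₀]; rfl
        rw [hR0, map_zero, hQbdef] at hφR
        cases hφR
      | some x₀ y₀ h₀ =>
        have h₀' : (T.E.baseChange T.Fbar).toAffine.Nonsingular (ι x₀) (ι y₀) :=
          (Affine.map_nonsingular (W := T.E.toAffine) (f := ι) hιinj x₀ y₀).mpr h₀
        have hRsome : R = Affine.Point.some (ι x₀) (ι y₀) h₀' := by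
          rw [← hR₀]; rfl
        rw [hRsome, AddEquiv.trans_apply, VariableChange.pointEquiv_some, Affine.Point.congrEquiv_some, hQbdef] at hφR
        injection hφR with hx hy
        -- `ι y = u⁻³ · ι(y₁)` with `y₁ ∈ F`
        set y₁ : T.F := y₀ + T.E.a₁ / 2 * (x₀ - β) + (T.E.a₃ + β * T.E.a₁) / 2 with hy₁def
        have hY : ι y₀ - C.s * (ι x₀ - C.r) - C.t = ι y₁ := by
          rw [hs, ht, hβ, hy₁def]
          simp only [map_add, map_sub, map_mul, map_div₀, map_neg, map_ofNat]
          ring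
        rw [VariableChange.toY_def, hY, Units.val_inv_eq_inv_val] at hy
        have hw0 : (C.u : T.Fbar) ≠ 0 := C.u.ne_zero
        by_cases hy1 : y₁ = 0
        · -- then `y = 0`: `Q` is a `2`-torsion point killed by `15`, i.e. `Q = 0` — absurd
          rw [hy1, map_zero, mul_zero] at hy
          have hy0 : y = 0 := (map_eq_zero_iff ι hιinj).mp hy.symm
          subst hy0
          have hneg : -(Affine.Point.some x 0 hxy : Θ.toAffine.Point) = Affine.Point.some x 0 hxy := by
            rw [Affine.Point.neg_some]
            congr 1
            simp [Affine.negY, hΘdef]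
          have h2 : (2 : ℤ) • (Affine.Point.some x 0 hxy : Θ.toAffine.Point) = 0 := by
            rw [two_zsmul]
            nth_rewrite 1 [← hneg]
            exact neg_add_cancel _
          have h0 : (Affine.Point.some x 0 hxy : Θ.toAffine.Point) = 0 := by
            have h := hQ
            rw [show (15 : ℤ) = 1 + 7 * 2 by norm_num, add_smul, one_smul, mul_smul, h2, smul_zero,
              add_zero] at h
            exact h
          cases h0
        · -- then `u³ = ι(y₁/y) ∈ F`, so `u = u³/u² ∈ F` and `α = u²` is a square in `F` — absurd
          have hιy0 : ι y ≠ 0 := by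
            intro h0
            rw [h0] at hy
            have h3 : ((C.u : T.Fbar))⁻¹ ^ 3 ≠ 0 := pow_ne_zero 3 (inv_ne_zero hw0)
            exact hy1 ((map_eq_zero_iff ι hιinj).mp ((mul_eq_zero.mp hy).resolve_left h3))
          have hu3 : (C.u : T.Fbar) ^ 3 = ι (y₁ / y) := by
            have hy' : ι y₁ = (C.u : T.Fbar) ^ 3 * ι y := by
              rw [← hy]; field_simp
            rw [map_div₀, hy']
            field_simp
          set a : T.F := y₁ / y / α with hadef
          have hua : (C.u : T.Fbar) = ι a := by
            have hια0 : ι α ≠ 0 := (map_ne_zero_iff ι hιinj).mpr hα0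
            calc (C.u : T.Fbar) = (C.u : T.Fbar) ^ 3 / (C.u : T.Fbar) ^ 2 := by field_simp
              _ = ι (y₁ / y) / ι α := by rw [hu3, hα]
              _ = ι a := by rw [hadef, map_div₀ ι (y₁ / y) α]
          exact hsq ⟨a, hιinj (by rw [map_mul, ← hua, ← hα, sq])⟩
/-! ## §6. At a rational point the twist class is trivial: `T.E ≅_F E_λ ⊗ F` -/

/-- `j(q) ≠ 0` for `q ∈ ℚ ∖ {0, 1}` (`q² − q + 1 > 0`). [folklore] -/
private theorem jInv_ne_zero_rat {q : ℚ} (h0 : q ≠ 0) (h1 : q ≠ 1) : jInv q ≠ 0 := by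
  unfold jInv
  have hpos : 0 < q ^ 2 - q + 1 := by nlinarith [sq_nonneg (2 * q - 1)]
  exact div_ne_zero (by positivity) (mul_ne_zero (pow_ne_zero 2 h0) (pow_ne_zero 2 (sub_ne_zero.mpr h1)))

/-- **THE FREE CURVE OF A GENUINE Θ-VOLUME DATUM AT A RATIONAL POINT IS THE LEGENDRE CURVE OVER `F`.** For `λ = q ∈ ℚ`
with `j(q) ≠ 1728` and EVERY `T : Cor22.ThetaVolumeDatumAt (ratPoint q) l`, there is a change of variables `C₀` OVER `T.F`
with `C₀ • T.E = thetaCurve (ratPoint q) T.F` (`= y² = x(x−1)(x−q)` over `F`): the clauses `j(T.E) = j(q)`,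
`T.E[30] ⊆ T.E(F)`, `IsSubThetaField` of model reading v3 already pin the quadratic twist class (§5 dichotomy; the second
branch would give `[F : ℚ] ≤ 8 < 16 ≤ [F : ℚ]`, §§3–4). So every «model clause» about the curve `E_F` of [IUTchIV] Thm. 1.10
at a rational point is a THEOREM of the typed datum. [cite: Mochizuki2012, IUTchIV Thm. 1.10 p. 22; Cor. 2.2 (ii) proof p. 46]
[cite: SilvermanAEC2009, Prop. X.5.4] [claim: Mochizuki2012, status: disputed] -/
theorem exists_variableChange_thetaCurve_ratPoint {q : ℚ} {l : ℕ} (T : ThetaVolumeDatumAt (ratPoint q) l)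
    (hj : jInv q ≠ 1728) :
    letI := T.instFieldF; letI := T.instNumberFieldF; letI := T.instAlgebraF; letI := T.instIsElliptic
    ∃ C₀ : VariableChange T.F, C₀ • T.E = thetaCurve (ratPoint q) T.F := by
  letI := T.instFieldF; letI := T.instNumberFieldF; letI := T.instAlgebraF; letI := T.instIsElliptic
  rcases T.exists_variableChange_thetaCurve_or_forall_torsion_eq_zero (jInv_ne_zero_rat T.inU.1 T.inU.2) hj with h | h
  · exact h
  · exfalso
    have h8 := T.finrank_le_eight_of_forall_torsion_eq_zero h
    have h16 := T.sixteen_le_finrank_ratPoint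
    omega

/-- The same isomorphism in the direction `E_q ⊗ F ↦ T.E` (`C₁ = C₀⁻¹`), the form in which reduction types, torsion and
semistability of `T.E` are transported to the Legendre curve. [cite: SilvermanAEC2009, Prop. X.5.4] [claim: Mochizuki2012, status: disputed] -/
theorem exists_variableChange_thetaCurve_ratPoint' {q : ℚ} {l : ℕ} (T : ThetaVolumeDatumAt (ratPoint q) l)
    (hj : jInv q ≠ 1728) :
    letI := T.instFieldF; letI := T.instNumberFieldF; letI := T.instAlgebraF; letI := T.instIsElliptic
    ∃ C₁ : VariableChange T.F, C₁ • thetaCurve (ratPoint q) T.F = T.E := by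
  letI := T.instFieldF; letI := T.instNumberFieldF; letI := T.instAlgebraF; letI := T.instIsElliptic
  obtain ⟨C₀, hC₀⟩ := T.exists_variableChange_thetaCurve_ratPoint hj
  exact ⟨C₀⁻¹, by rw [← hC₀, smul_smul, inv_mul_cancel, one_smul]⟩

end ThetaVolumeDatumAt

end Cor22

end Literature.IUT.LogVolume

end
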